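import Summits.BirchSwinnertonDyer.BirchSwinnertonDyer.Theorems.Rank2ObservatoryCubicFieldR195885
import HarnessLib

/-!
# BirchSwinnertonDyer — rank ≥ 2 observatory: class number one of the cubic field of `-25 + 66 * X - 18 * X ^ 2 + X ^ 3` (`Δ = 195885`) — certificates at the primes 109, 113

HONEST FRAMING: per-curve certified theorems and census instruments; no claim on BSD in rank ≥ 2.

Companion of the per-FIELD file `Rank2ObservatoryCubicFieldR195885` of the KERNEL-2DESC instrument (design
`b2b-bsdr2-cert-3/KERNEL-2DESC.md` §9e–§9g): the degree-one prime-element certificates at the primes 109, 113 (part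
b). Split off for file size; generated by the same generator from the same checked data.
Sorry-free; axioms `propext`, `Classical.choice`, `Quot.sound`.
[cite: Marcus2018, Ch. 3 Thm. 27, Ch. 5 Cor. 2 of Thm. 37]
-/

-- single-conjunct summit: `Summit.BirchSwinnertonDyer.BirchSwinnertonDyer.…` repeats the name by design
set_option linter.dupNamespace false

noncomputable section

open scoped Classical NumberField

open Literature.NumberTheory.NumberFields Polynomial Module NumberField

namespace Summit.BirchSwinnertonDyer.BirchSwinnertonDyer.Rank2Observatory.TwoDescCubic

namespace FieldR195885

/-! ## Class number one -/

/-- Certificate at `109`: `g` has no root mod `109`, so there is no ring map `𝓞 K → ℤ/109`. [folklore] -/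
theorem cert109 (ψ : 𝓞 (CubicField (-18) 66 (-25)) →+* ZMod 109) : ∃ e : 𝓞 (CubicField (-18) 66 (-25)), ψ e = 0 ∧ Prime e :=
  cert_of_no_root aeval_α ψ (by decide +kernel)

/-- Certificate at `113`: `g` has no root mod `113`, so there is no ring map `𝓞 K → ℤ/113`. [folklore] -/
theorem cert113 (ψ : 𝓞 (CubicField (-18) 66 (-25)) →+* ZMod 113) : ∃ e : 𝓞 (CubicField (-18) 66 (-25)), ψ e = 0 ∧ Prime e :=
  cert_of_no_root aeval_α ψ (by decide +kernel)

end FieldR195885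

end Summit.BirchSwinnertonDyer.BirchSwinnertonDyer.Rank2Observatory.TwoDescCubic

end
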